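import Literature.NumberTheory.DiophantineGeometry.FunctionFieldResidues
import Literature.LinearAlgebra.TateResidue.TraceFormula
import Mathlib.RingTheory.Trace.Basic
import HarnessLib

/-!
# The local residue at an arbitrary place: `res_P(h π⁻¹ dπ) = Tr_{κ(P)/K}(h(P))` and
`res_P(a g⁻¹ dg) = v_P(g) · Tr_{κ(P)/K}(a(P))` (Tate 1968, §2 (R4), §3 Thm. 2)

Continuation of `FunctionFieldResidues` (local residues `res_P(f dg) = P.localRes K f g`, the residue
theorem `sum_localRes_eq_zero`), which proves Tate's rule (R4) only at RATIONAL places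
(`IsRational.localRes_inv_uniformizer : res_P(π⁻¹ dπ) = 1`). Using Tate's rule (R4) with a
multiplier (`Literature.LinearAlgebra.TateResidue.TraceFormula.res_mul_inv_eq_trace`:
`res_A(h g⁻¹ dg) = Tr_{A/gA}(h̄)`), this file proves the trace formula at an arbitrary place `P` of an
algebraic function field `F/K`:

* `quotMapComapEquiv`: `𝒪_P / π 𝒪_P ≃ₗ[K] κ(P)` (Tate's quotient `A/gA` for `A = 𝒪_P`, `g = π`);
* **`localRes_mul_inv_uniformizer`**: `res_P(h π⁻¹ dπ) = Tr_{κ(P)/K}(h̄)` for `h ∈ 𝒪_P`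
  (Tate 1968, §2 (R4): the endomorphism `h̄` of `A/gA = κ(P)` is multiplication by the residue class
  of `h`, whose trace is the field trace);
* **`localRes_mul_inv_eq_ord_mul_trace`**: `res_P(a g⁻¹ dg) = v_P(g) · Tr_{κ(P)/K}(ā)` for `a ∈ 𝒪_P`,
  `g ≠ 0` (write `g = πⁿ u`; `res_P(a u⁻¹ du) = 0` by (R2) and `d(πⁿ) = n πⁿ⁻¹ dπ`), the form in
  which logarithmic differentials enter reciprocity laws (e.g. for Artin–Schreier coverings:
  `Σ_P v_P(g) Tr_{κ(P)/K}(a(P)) = -res_∞`, by the residue theorem).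

Everything is proved; no named facts.

## References

* J. Tate, *Residues of differentials on curves*, Ann. Sci. École Norm. Sup. (4) 1 (1968), 149–159,
  §2 (R2)–(R4), §3 Thm. 2. [Tate1968]
* H. Stichtenoth, *Algebraic Function Fields and Codes*, 2nd ed., GTM 254, Springer 2009,
  Def. 1.1.14, Prop. 4.2.9 / Cor. 4.3.3 (residues and traces). [Stichtenoth2009]
-/

noncomputable section

open scoped Classical
open Literature.LinearAlgebra.TateResidue.Tate Module

namespace Literature.NumberTheory.DiophantineGeometry.AlgFunctionField

universe u v

variable {K : Type u} {F : Type v} [Field K] [Field F] [Algebra K F]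

namespace PlaceOver

section TraceFormula

variable [IsAlgFunctionField K F] (P : PlaceOver K F)

omit [IsAlgFunctionField K F] in
/-- Tate's `gA ⊆ A` for `A = 𝒪_P`, `g = π`: the subspace `π 𝒪_P` of `𝒪_P` is the ball `v_P ≥ 1`.
[cite: Tate1968, §2, (R4)] -/
theorem mem_mapComap_mulLeft_uniformizer_iff (x : P.intSubmodule K) :
    x ∈ mapComap (P.intSubmodule K) (LinearMap.mulLeft K (P.uniformizer : F)) ↔ (x : F) ∈ P.ball 1 := by
  rw [mem_mapComap_iff]
  constructor
  · rintro ⟨y, hy, hyx⟩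
    rw [← hyx, LinearMap.mulLeft_apply, mem_ball_iff, zpow_one, Valuation.map_mul]
    exact mul_le_of_le_one_right' ((P.toValuationSubring.valuation_le_one_iff y).2
      ((P.mem_ball_zero_iff y).1 hy))
  · intro hx
    refine ⟨(x : F) * (P.uniformizer : F) ^ (-(1 : ℤ)),
      (P.mem_ball_zero_iff _).2 (P.mul_uniformizer_zpow_neg_mem 1 hx), ?_⟩
    rw [LinearMap.mulLeft_apply, zpow_neg, zpow_one, mul_comm, mul_assoc,
      inv_mul_cancel₀ P.coe_uniformizer_ne_zero, mul_one]

/-- The residue map `𝒪_P → κ(P)` on Tate's `A = 𝒪_P` (a `K`-linear surjection with kernel `π 𝒪_P`).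
[cite: Tate1968, §2, (R4)] -/
def intResidue : P.intSubmodule K →ₗ[K] P.residueField where
  toFun y := IsLocalRing.residue P.toValuationSubring ⟨(y : F), (P.mem_ball_zero_iff _).1 y.2⟩
  map_add' y z := by
    rw [← map_add]
    rfl
  map_smul' c y := by
    rw [RingHom.id_apply, Algebra.smul_def, PlaceOver.algebraMap_residueField_apply, ← map_mul]
    congr 1
    apply Subtype.ext
    simp [Algebra.smul_def]

omit [IsAlgFunctionField K F] in
/-- `intResidue` on elements (definitional). [folklore] -/
theorem intResidue_apply (y : P.intSubmodule K) :
    P.intResidue y = IsLocalRing.residue P.toValuationSubring ⟨(y : F), (P.mem_ball_zero_iff _).1 y.2⟩ :=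
  rfl

omit [IsAlgFunctionField K F] in
/-- `intResidue` is onto. [folklore] -/
theorem intResidue_surjective : Function.Surjective P.intResidue := by
  intro r
  obtain ⟨⟨y, hy⟩, rfl⟩ := IsLocalRing.residue_surjective r
  exact ⟨⟨y, (P.mem_ball_zero_iff y).2 hy⟩, rfl⟩

omit [IsAlgFunctionField K F] in
/-- The kernel of `intResidue` is `π 𝒪_P`. [folklore] -/
theorem ker_intResidue :
    LinearMap.ker P.intResidue = mapComap (P.intSubmodule K) (LinearMap.mulLeft K (P.uniformizer : F)) := by
  ext x
  rw [LinearMap.mem_ker, mem_mapComap_mulLeft_uniformizer_iff, intResidue_apply,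
    IsLocalRing.residue_eq_zero_iff, ValuationSubring.valuation_lt_one_iff, P.mem_ball_iff 1 (x : F),
    zpow_one, ← P.valuation_lt_one_iff_le]

/-- **`𝒪_P / π𝒪_P ≅ κ(P)`** as `K`-vector spaces (Tate's `A/gA` is the residue field).
[cite: Tate1968, §2, (R4)] [cite: Stichtenoth2009, Def. 1.1.14] -/
def quotMapComapEquiv :
    (P.intSubmodule K ⧸ mapComap (P.intSubmodule K) (LinearMap.mulLeft K (P.uniformizer : F))) ≃ₗ[K]
      P.residueField :=
  (Submodule.quotEquivOfEq _ _ P.ker_intResidue.symm).trans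
    (P.intResidue.quotKerEquivOfSurjective P.intResidue_surjective)

omit [IsAlgFunctionField K F] in
/-- `quotMapComapEquiv [y] = ȳ`. [folklore] -/
theorem quotMapComapEquiv_mk (y : P.intSubmodule K) :
    P.quotMapComapEquiv (Submodule.Quotient.mk y) = P.intResidue y :=
  rfl

/-- `𝒪_P/π𝒪_P` is finite-dimensional over `K` (it is `κ(P)`, Stichtenoth Prop. 1.1.15). [cite: Stichtenoth2009, Prop. 1.1.15] -/
instance finiteDimensional_quotMapComap :
    FiniteDimensional K
      (P.intSubmodule K ⧸ mapComap (P.intSubmodule K) (LinearMap.mulLeft K (P.uniformizer : F))) := by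
  haveI : FiniteDimensional K P.residueField := PlaceOver.finiteDimensional_residueField_holds P
  exact LinearEquiv.finiteDimensional P.quotMapComapEquiv.symm

/-- **Tate's (R4) at an arbitrary place: `res_P(h π⁻¹ dπ) = Tr_{κ(P)/K}(h̄)`** for `h ∈ 𝒪_P` and the
local parameter `π = P.uniformizer` (Tate 1968, §2 (R4): `res_A(h g⁻¹ dg) = Tr_{A/gA}(h̄)` with
`A = 𝒪_P`, `g = π`, `A/gA = κ(P)` on which `h̄` is multiplication by the residue class of `h`; at a
rational place this is `h(P)`, Thm. 2). [cite: Tate1968, §2 (R4) and §3 Thm. 2] -/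
theorem localRes_mul_inv_uniformizer {h : F} (hh : h ∈ P.toValuationSubring) :
    P.localRes K (h * (P.uniformizer : F)⁻¹) (P.uniformizer : F) =
      Algebra.trace K P.residueField (IsLocalRing.residue P.toValuationSubring ⟨h, hh⟩) := by
  have hhA : ∀ x ∈ P.intSubmodule K, LinearMap.mulLeft K h x ∈ P.intSubmodule K :=
    fun x hx => P.map_mulLeft_intSubmodule_le hh ⟨x, hx, rfl⟩
  have hhg : Commute (LinearMap.mulLeft K h) (LinearMap.mulLeft K (P.uniformizer : F)) :=
    commute_mulLeft h _
  rw [localRes, mulLeft_mul',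
    res_mul_inv_eq_trace (A := P.intSubmodule K) (g' := LinearMap.mulLeft K (P.uniformizer : F)⁻¹)
      (by rw [← mulLeft_mul', inv_mul_cancel₀ P.coe_uniformizer_ne_zero, LinearMap.mulLeft_one]; rfl)
      (P.map_mulLeft_intSubmodule_le P.uniformizer.2) hhA hhg,
    ← LinearMap.trace_conj' _ P.quotMapComapEquiv, Algebra.trace_apply]
  congr 1
  apply LinearMap.ext
  intro r
  obtain ⟨y, rfl⟩ := P.intResidue_surjective r
  change P.quotMapComapEquiv (quotMap (P.intSubmodule K) (LinearMap.mulLeft K (P.uniformizer : F))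
      (LinearMap.mulLeft K h) hhA hhg (P.quotMapComapEquiv.symm (P.intResidue y))) =
    IsLocalRing.residue P.toValuationSubring ⟨h, hh⟩ * P.intResidue y
  rw [← quotMapComapEquiv_mk, LinearEquiv.symm_apply_apply, quotMap_mk, quotMapComapEquiv_mk,
    quotMapComapEquiv_mk, intResidue_apply, intResidue_apply, ← map_mul]
  rfl

/-- **`res_P(a g⁻¹ dg) = v_P(g) · Tr_{κ(P)/K}(ā)`** for `a ∈ 𝒪_P` and `g ≠ 0`: write `g = πⁿ u` with
`n = v_P(g)` and `u` a unit; then `a g⁻¹ dg = a u⁻¹ du + n a π⁻¹ dπ`, the first term has residue `0`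
by (R2), the second `n Tr(ā)` by (R4). [cite: Tate1968, §2 (R2)–(R4) and §3 Thm. 2] -/
theorem localRes_mul_inv_eq_ord_mul_trace {a g : F} (ha : a ∈ P.toValuationSubring) (hg : g ≠ 0) :
    P.localRes K (a * g⁻¹) g =
      (P.ord g : K) * Algebra.trace K P.residueField (IsLocalRing.residue P.toValuationSubring ⟨a, ha⟩) := by
  set π : F := (P.uniformizer : F) with hπ
  set n : ℤ := P.ord g with hn
  have hπ0 : π ≠ 0 := P.coe_uniformizer_ne_zero
  -- the unit `u = g π^{-n}`
  set u : F := g * π ^ (-n) with hu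
  have hu1 : P.valuation u = 1 := by
    rw [hu, Valuation.map_mul, map_zpow₀, P.valuation_eq_zpow_ord hg, ← hn, ← zpow_add₀
      P.valuation_uniformizer_ne_zero, add_neg_cancel, zpow_zero]
  have humem : u ∈ P.toValuationSubring := ((P.valuation_eq_one_iff u).1 hu1).1
  have hu0 : u ≠ 0 := by
    intro h0; rw [h0, Valuation.map_zero] at hu1; exact zero_ne_one hu1
  have huinv : u⁻¹ ∈ P.toValuationSubring := by
    rw [← P.toValuationSubring.valuation_le_one_iff]
    change P.valuation u⁻¹ ≤ 1
    rw [map_inv₀, hu1, inv_one]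
  have hgu : g = π ^ n * u := by
    rw [hu, mul_left_comm, ← zpow_add₀ hπ0, add_neg_cancel, zpow_zero, mul_one]
  have hginv : g⁻¹ = π ^ (-n) * u⁻¹ := by rw [hgu, mul_inv, zpow_neg]
  -- Leibniz
  rw [hgu, P.localRes_mul_right]
  have e1 : a * g⁻¹ * π ^ n = a * u⁻¹ := by
    rw [hginv, mul_assoc, mul_assoc, mul_comm (u⁻¹) (π ^ n), ← mul_assoc (π ^ (-n)), zpow_neg,
      inv_mul_cancel₀ (zpow_ne_zero n hπ0), one_mul]
  have e2 : a * g⁻¹ * u = a * π ^ (-n) := by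
    rw [hginv, mul_assoc, mul_assoc, inv_mul_cancel₀ hu0, mul_one]
  rw [← hgu, e1, e2, P.localRes_eq_zero_of_mem (mul_mem ha huinv) humem, zero_add,
    P.localRes_zpow_right _ hπ0 n]
  have e3 : a * π ^ (-n) * π ^ (n - 1) = a * π⁻¹ := by
    rw [mul_assoc, ← zpow_add₀ hπ0, show -n + (n - 1) = -1 by ring, zpow_neg_one]
  rw [e3, P.localRes_mul_inv_uniformizer ha]

/-- The case `a = 1`: **`res_P(g⁻¹ dg) = v_P(g) · deg P`** (in `K`; `Tr_{κ(P)/K}(1) = [κ(P) : K]`).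
[cite: Tate1968, §2 (R4)] -/
theorem localRes_inv_eq_ord_mul_degree {g : F} (hg : g ≠ 0) :
    P.localRes K g⁻¹ g = (P.ord g : K) * (P.degree : K) := by
  have h := P.localRes_mul_inv_eq_ord_mul_trace (a := 1) (one_mem _) hg
  rw [one_mul] at h
  rw [h]
  congr 1
  have h1 : (IsLocalRing.residue P.toValuationSubring ⟨(1 : F), one_mem _⟩ : P.residueField) = 1 := by
    rw [← map_one (IsLocalRing.residue P.toValuationSubring)]; rfl
  rw [h1, show (1 : P.residueField) = algebraMap K P.residueField 1 from (map_one _).symm,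
    Algebra.trace_algebraMap, nsmul_eq_mul, mul_one]
  rfl

end TraceFormula

end PlaceOver

end Literature.NumberTheory.DiophantineGeometry.AlgFunctionField
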